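import Literature.Barriers.CriticalPhenomena.PlaquetteWalkHoleRootCutLawSharp
import HarnessLib

/-!
# Barrier catalogue (SAWScalingLimit): THE RING + NEAR PAIR CENSUS AS A THEOREM — nine unmarked witnesses decide the
«found» side of all sixty pairs, in every box with the hole three cells from the walls

Leaf of `PlaquetteWalkHoleRootCutLawSharp` (placement under a two-cell defect list `block_hroot_subset_boxMinus_pair`; the witness
transport `exists_wound_witness_shift` and the certificates `arc_mem_of_check` / `noncross_of_check` / `eastRayB` are in its cone).
Setting: the `m × n` box, hole `h` at least three cells from every wall (`3 ≤ h.1`, `h.1 + 4 ≤ m`, `3 ≤ h.2`, `h.2 + 4 ≤ n`), root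
plaquette `(h.1 + 1, h.2)` rooted at `W`, far cell `(h.1 − 1, h.2)`; reference coordinates: root `(4, 2)`, hole `(3, 2)`, far cell `(2, 2)`,
RING = the sixteen cells at Chebyshev distance two from the hole minus the far cell's outer neighbour `farWW = (1, 2)` (a door of the far
cell), NEAR = `holeS = (3,1)`, `rootS = (4,1)`, `holeN = (3,3)`, `rootN = (4,3)`. The venture lane's kit census j300087 (FINDING-YB-KILL-
FORCED-ZEROS §27; 15 ring cells × 4 near cells × 4 witness types = 240 tasks in the frame `[0,6]×[−1,5]`) returned 202 FOUND, 38 TIMEOUT;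
the cut theory decided the timeouts (16 route-cells EMPTY — `PlaquetteWalkHoleRootCutLaw` §3′, `…RootNotchLiveColumn`, `…OneLiveRow`
— and 6 slow FOUNDs, §28 add. 1/5). This file makes the FOUND side a theorem, uniformly and in a stronger form:

* §1 NINE explicit wound witnesses `pairBlockU1…U4` (under, first side `S`) and `pairBlockO1…O5` (over, first side `N`), 28–34 arcs,
  each UNMARKED — every rhombus carries one arc, so the walk is `w₁`-free AND `w₂`-free off the far cell (a hexagonal self-avoiding walk
  at both hexagonal angles) —, produced by the lane's constructive generator as a greedy cover of the 208 found (pair, type) cells and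
  certified by the kernel (`decide`) at the reference position; every-position transport `exists_under/over_unmarked_of_pairBlock*`.
* §2 THE CENSUS LISTS `ringNearHarmlessPairs` (44 pairs: all four types found), `ringNearUnderPairs` (8 pairs `{top-row ring cell or
  rootE/pNE/K_N2} × {holeN, rootN}` whose OVER route is empty in the frame: under found), `ringNearOverPairs` (the 8 row mirrors), with
  `ringNear_pairs_complete` (the three lists are the 60 pairs, no repeats) and the COVER LEMMAS `ringNear_under_cover` /
  `ringNear_over_cover` (`decide`: every listed pair is avoided, inside the frame, by one of the four under / five over blocks).
* §3 ★★★★★ `exists_under_unmarked_of_ringNearPair` / `exists_over_unmarked_of_ringNearPair` — in EVERY box with the hole three cells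
  from the walls, for EVERY pair `(c, d)` of the under list (52 pairs) resp. over list (52 pairs) and every defect list `S ∋ h` inside
  `{h, c + v, d + v}` (`v` the shift to the hole), the route carries a wound class-`B2a` walk free in BOTH classes; ★★★★★
  `lawL_box_ringNearPair_not_killed` — for the 44 harmless pairs NONE of the four honeycomb kill statements of LAW L holds. With the
  parent lineage's emptiness theorems this is the whole 240-cell census as theorems, and more: every found cell is found by an
  unmarked walk, in every larger room.

Not in print; venture lane «pcv-sawmu», seat b-step0 gen 30 (kit j300087 of b-step0 gen 28, `HOME/code/step0/g28/kit/`; generator and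
cover `HOME/code/step0/g30/{gen,pairs}/`).

References: A. Glazman, I. Manolescu, arXiv:1708.00395v3, §1 (Fig. 1, Fig. 2, remark after eq. (1)), §2.1, §4.2 (translation
invariance), Lemma 2.1 [GlazmanManolescu2019]; A. Glazman, Electron. Commun. Probab. 20 (2015) no. 86, Lemma 3.1, proof pp. 6–7
[Glazman2015WeightedSAW]; R. Courant, H. Robbins, *What is Mathematics?* (1941/1958), Ch. V Appendix §2 (the even–odd rule)
[CourantRobbins1958].
-/

noncomputable section

open Set Function Complex

namespace Literature.Barriers.CriticalPhenomena.PlaquetteWalk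

open Literature.Probability.RandomPlanarGeometry.SAW.YangBaxter
open Real Complex

/-! ## §1 Nine unmarked wound witnesses (reference root `w42 = (4, 2)`, hole `(3, 2)`, far cell `(2, 2)`), every position -/

section Witnesses

/-- Pair-census witness block `U1`: the 32 cells of an under wound witness, UNMARKED (one arc per rhombus: `w₁`-free and
`w₂`-free off the far cell), reference root `(4, 2)`, hole `(3, 2)`, far cell `(2, 2)`, cells in the frame `[0,6]×[−1,5]`, AVOIDING
`(1,0)`, `(1,1)`, `(1,3)`, `(1,4)`, `(3,1)`, `(3,3)`, `(3,4)`, `(4,1)`, `(4,3)`, `(4,4)`, `(5,3)`, `(5,4)` (covers 64 (pair, type) cells of kit j300087; constructive generator `wgen.py`, seat b-step0 gen 30).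
[cite: GlazmanManolescu2019, §2.1 (finite domains of faces)] -/
def pairBlockU142 : List Face :=
  [(0,-1),(0,0),(0,1),(0,2),(1,-1),(1,2),(2,-1),(2,0),(2,1),(2,2),(2,3),(2,4),(2,5),(3,-1),(3,0),(3,5),(4,-1),(4,0),
  (4,2),(4,5),(5,-1),(5,0),(5,1),(5,2),(5,5),(6,-1),(6,0),(6,1),(6,2),(6,3),(6,4),(6,5)]

/-- Its mid-edges (32 arcs). [cite: GlazmanManolescu2019, §1 (definition of the model), Fig. 1] -/
def pairU1Mids : List MidEdge :=
  [.vert 4 2, .vert 5 2, .slant 5 2, .slant 5 1, .vert 5 0, .vert 4 0, .vert 3 0, .slant 2 1, .slant 2 2, .vert 2 2,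
  .vert 1 2, .slant 0 2, .slant 0 1, .slant 0 0, .vert 1 (-1), .vert 2 (-1), .vert 3 (-1), .vert 4 (-1), .vert 5 (-1),
  .vert 6 (-1), .slant 6 0, .slant 6 1, .slant 6 2, .slant 6 3, .slant 6 4, .slant 6 5, .vert 6 5, .vert 5 5,
  .vert 4 5, .vert 3 5, .slant 2 5, .slant 2 4, .slant 2 3]

/-- The witness as a walk of its block. [cite: GlazmanManolescu2019, §1 (definition of the model), Fig. 1] -/
def pairU1Walk : YBWalk (dom pairBlockU142) (w42.side .W) ((farW w42).side .N) where
  mids := pairU1Mids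
  head_eq := by decide
  getLast_eq := by decide
  nodup := by decide
  arc_mem := arc_mem_of_check (by decide)
  isChain := by decide
  noncross := noncross_of_check (by decide)

/-- The labelled witness. [cite: Glazman2015WeightedSAW, Lemma 3.1 (proof, pp. 6–7)] -/
def ωpairU1 : ΩG (dom pairBlockU142) (w42.side .W) (farW w42) := ⟨.N, pairU1Walk⟩

/-- Certificates: first hit `8`, `32` arcs, no later far-cell arc, first side `S`, `w₁`-free and `w₂`-free off the far
cell, odd eastern-ray count. [cite: Glazman2015WeightedSAW, Lemma 3.1 (proof, pp. 6–7)] [cite: CourantRobbins1958, Ch. V Appendix §2 (the even–odd rule)] -/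
theorem ωpairU1_cert : ωpairU1.2.firstHitG = 8 ∧ ωpairU1.2.arcs.length = 32 ∧
    (∀ j < 32, 8 < j → ωpairU1.2.fc j ≠ farW w42) ∧ ωpairU1.2.nth 8 = (farW w42).side .S ∧
    (ωpairU1.2.W1FreeOff (farW w42) ∧ ωpairU1.2.W2FreeOff (farW w42)) ∧
    Odd ((Finset.range 24).filter fun j => eastRayB w42 (ωpairU1.2.nth (8 + j + 1)) = true).card := by
  refine ⟨by decide, by decide, by decide, by decide, ⟨by unfold YBWalk.W1FreeOff; decide, by unfold YBWalk.W2FreeOff; decide⟩,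
    by decide⟩

/-- The block at the root plaquette `w`. [cite: GlazmanManolescu2019, §2.1, §4.2 (translation invariance)] -/
def pairBlockU1 (w : Face) : List Face := pairBlockU142.map (Face.shiftBy (refShift w))

/-- ★★★ The unmarked under wound witness `U1` at EVERY POSITION: any face list containing the translated block carries a
wound class-`B2a` under-walk at the far cell, `w₁`-free and `w₂`-free off it.
[cite: GlazmanManolescu2019, §4.2 (translation invariance), Lemma 2.1]
[cite: Glazman2015WeightedSAW, Lemma 3.1 (proof, pp. 6–7)] [cite: CourantRobbins1958, Ch. V Appendix §2 (the even–odd rule)] -/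
theorem exists_under_unmarked_of_pairBlockU1 {Dl : List Face} {w : Face} (hB : ∀ c ∈ pairBlockU1 w, c ∈ Dl)
    (hr : RootedFace (dom Dl) (w.side .W) (farW w)) (θ : ℝ) :
    ∃ (ω : ΩG (dom Dl) (w.side .W) (farW w)) (h : ω.IsB2a), ω.2.firstSideG = .S ∧
      ω.WE (fun _ => θ) ≠ excursionWinding θ ω.2.firstSideG (ω.z1 hr h) ω.1 ∧
        (ω.2.W1FreeOff (farW w) ∧ ω.2.W2FreeOff (farW w)) := by
  have hB₀ := block42_mem_of_block_mem (B := pairBlockU142) hB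
  obtain ⟨hF, hn, hfc, hnth, hfree, hodd⟩ := ωpairU1_cert
  let ω₀ : ΩG (dom (Dl.map (Face.shiftBy (-refShift w)))) (w42.side .W) (farW w42) :=
    ⟨.N, pairU1Walk.mapDomain fun c hc => hB₀ c hc⟩
  have hF' : ω₀.2.firstHitG = 8 := hF
  have hn' : ω₀.2.arcs.length = 32 := hn
  have h₀ : ω₀.IsB2a := by
    refine ΩG.isB2a_of_forall_fc_ne (by rw [hF', hn']; omega) fun j hj1 hj2 => ?_
    rw [hF'] at hj1
    rw [hn'] at hj2
    exact hfc j hj2 hj1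
  have hM : ω₀.Mv = 24 := by unfold ΩG.Mv; rw [hF', hn']
  exact exists_wound_witness_shift (shiftBy_refShift_root w) (shiftBy_refShift_farW w) hr
    (fun γ r => γ.W1FreeOff r ∧ γ.W2FreeOff r)
    (fun hm _ hf => ⟨YBWalk.W1FreeOff_of_mids_shift hm hf.1, YBWalk.W2FreeOff_of_mids_shift hm hf.2⟩) ω₀ h₀
    (by rw [hF']; exact hnth) hfree (by rw [hM, hF']; exact hodd) θ

/-- Pair-census witness block `U2`: the 32 cells of an under wound witness, UNMARKED (one arc per rhombus: `w₁`-free and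
`w₂`-free off the far cell), reference root `(4, 2)`, hole `(3, 2)`, far cell `(2, 2)`, cells in the frame `[0,6]×[−1,5]`, AVOIDING
`(2,0)`, `(2,4)`, `(3,0)`, `(3,3)`, `(4,0)`, `(4,3)`, `(5,0)`, `(5,1)`, `(5,2)` (covers 28 (pair, type) cells of kit j300087; constructive generator `wgen.py`, seat b-step0 gen 30).
[cite: GlazmanManolescu2019, §2.1 (finite domains of faces)] -/
def pairBlockU242 : List Face :=
  [(0,-1),(0,0),(0,1),(0,2),(1,-1),(1,0),(1,1),(1,2),(1,3),(1,4),(1,5),(2,-1),(2,1),(2,2),(2,3),(2,5),(3,-1),(3,1),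
  (3,4),(3,5),(4,-1),(4,1),(4,2),(4,4),(5,-1),(5,3),(5,4),(6,-1),(6,0),(6,1),(6,2),(6,3)]

/-- Its mid-edges (32 arcs). [cite: GlazmanManolescu2019, §1 (definition of the model), Fig. 1] -/
def pairU2Mids : List MidEdge :=
  [.vert 4 2, .slant 4 2, .vert 4 1, .vert 3 1, .slant 2 2, .vert 2 2, .vert 1 2, .slant 0 2, .vert 1 1, .slant 1 1,
  .vert 1 0, .slant 0 0, .vert 1 (-1), .vert 2 (-1), .vert 3 (-1), .vert 4 (-1), .vert 5 (-1), .vert 6 (-1),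
  .slant 6 0, .slant 6 1, .slant 6 2, .slant 6 3, .vert 6 3, .slant 5 4, .vert 5 4, .vert 4 4, .slant 3 5, .vert 3 5,
  .vert 2 5, .slant 1 5, .slant 1 4, .vert 2 3, .slant 2 3]

/-- The witness as a walk of its block. [cite: GlazmanManolescu2019, §1 (definition of the model), Fig. 1] -/
def pairU2Walk : YBWalk (dom pairBlockU242) (w42.side .W) ((farW w42).side .N) where
  mids := pairU2Mids
  head_eq := by decide
  getLast_eq := by decide
  nodup := by decide
  arc_mem := arc_mem_of_check (by decide)
  isChain := by decide
  noncross := noncross_of_check (by decide)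

/-- The labelled witness. [cite: Glazman2015WeightedSAW, Lemma 3.1 (proof, pp. 6–7)] -/
def ωpairU2 : ΩG (dom pairBlockU242) (w42.side .W) (farW w42) := ⟨.N, pairU2Walk⟩

/-- Certificates: first hit `4`, `32` arcs, no later far-cell arc, first side `S`, `w₁`-free and `w₂`-free off the far
cell, odd eastern-ray count. [cite: Glazman2015WeightedSAW, Lemma 3.1 (proof, pp. 6–7)] [cite: CourantRobbins1958, Ch. V Appendix §2 (the even–odd rule)] -/
theorem ωpairU2_cert : ωpairU2.2.firstHitG = 4 ∧ ωpairU2.2.arcs.length = 32 ∧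
    (∀ j < 32, 4 < j → ωpairU2.2.fc j ≠ farW w42) ∧ ωpairU2.2.nth 4 = (farW w42).side .S ∧
    (ωpairU2.2.W1FreeOff (farW w42) ∧ ωpairU2.2.W2FreeOff (farW w42)) ∧
    Odd ((Finset.range 28).filter fun j => eastRayB w42 (ωpairU2.2.nth (4 + j + 1)) = true).card := by
  refine ⟨by decide, by decide, by decide, by decide, ⟨by unfold YBWalk.W1FreeOff; decide, by unfold YBWalk.W2FreeOff; decide⟩,
    by decide⟩

/-- The block at the root plaquette `w`. [cite: GlazmanManolescu2019, §2.1, §4.2 (translation invariance)] -/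
def pairBlockU2 (w : Face) : List Face := pairBlockU242.map (Face.shiftBy (refShift w))

/-- ★★★ The unmarked under wound witness `U2` at EVERY POSITION: any face list containing the translated block carries a
wound class-`B2a` under-walk at the far cell, `w₁`-free and `w₂`-free off it.
[cite: GlazmanManolescu2019, §4.2 (translation invariance), Lemma 2.1]
[cite: Glazman2015WeightedSAW, Lemma 3.1 (proof, pp. 6–7)] [cite: CourantRobbins1958, Ch. V Appendix §2 (the even–odd rule)] -/
theorem exists_under_unmarked_of_pairBlockU2 {Dl : List Face} {w : Face} (hB : ∀ c ∈ pairBlockU2 w, c ∈ Dl)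
    (hr : RootedFace (dom Dl) (w.side .W) (farW w)) (θ : ℝ) :
    ∃ (ω : ΩG (dom Dl) (w.side .W) (farW w)) (h : ω.IsB2a), ω.2.firstSideG = .S ∧
      ω.WE (fun _ => θ) ≠ excursionWinding θ ω.2.firstSideG (ω.z1 hr h) ω.1 ∧
        (ω.2.W1FreeOff (farW w) ∧ ω.2.W2FreeOff (farW w)) := by
  have hB₀ := block42_mem_of_block_mem (B := pairBlockU242) hB
  obtain ⟨hF, hn, hfc, hnth, hfree, hodd⟩ := ωpairU2_cert
  let ω₀ : ΩG (dom (Dl.map (Face.shiftBy (-refShift w)))) (w42.side .W) (farW w42) :=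
    ⟨.N, pairU2Walk.mapDomain fun c hc => hB₀ c hc⟩
  have hF' : ω₀.2.firstHitG = 4 := hF
  have hn' : ω₀.2.arcs.length = 32 := hn
  have h₀ : ω₀.IsB2a := by
    refine ΩG.isB2a_of_forall_fc_ne (by rw [hF', hn']; omega) fun j hj1 hj2 => ?_
    rw [hF'] at hj1
    rw [hn'] at hj2
    exact hfc j hj2 hj1
  have hM : ω₀.Mv = 28 := by unfold ΩG.Mv; rw [hF', hn']
  exact exists_wound_witness_shift (shiftBy_refShift_root w) (shiftBy_refShift_farW w) hr
    (fun γ r => γ.W1FreeOff r ∧ γ.W2FreeOff r)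
    (fun hm _ hf => ⟨YBWalk.W1FreeOff_of_mids_shift hm hf.1, YBWalk.W2FreeOff_of_mids_shift hm hf.2⟩) ω₀ h₀
    (by rw [hF']; exact hnth) hfree (by rw [hM, hF']; exact hodd) θ

/-- Pair-census witness block `U3`: the 30 cells of an under wound witness, UNMARKED (one arc per rhombus: `w₁`-free and
`w₂`-free off the far cell), reference root `(4, 2)`, hole `(3, 2)`, far cell `(2, 2)`, cells in the frame `[0,6]×[−1,5]`, AVOIDING
`(2,4)`, `(3,1)`, `(5,0)`, `(5,1)`, `(5,2)` (covers 8 (pair, type) cells of kit j300087; constructive generator `wgen.py`, seat b-step0 gen 30).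
[cite: GlazmanManolescu2019, §2.1 (finite domains of faces)] -/
def pairBlockU342 : List Face :=
  [(0,-1),(0,0),(0,1),(0,2),(0,3),(1,-1),(1,0),(1,1),(1,2),(1,3),(2,-1),(2,0),(2,1),(2,2),(2,3),(3,-1),(3,0),(3,3),
  (4,-1),(4,0),(4,1),(4,2),(4,3),(5,-1),(5,3),(6,-1),(6,0),(6,1),(6,2),(6,3)]

/-- Its mid-edges (30 arcs). [cite: GlazmanManolescu2019, §1 (definition of the model), Fig. 1] -/
def pairU3Mids : List MidEdge :=
  [.vert 4 2, .slant 4 2, .slant 4 1, .vert 4 0, .vert 3 0, .slant 2 1, .slant 2 2, .vert 2 2, .slant 1 3, .vert 1 3,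
  .slant 0 3, .slant 0 2, .vert 1 1, .slant 1 1, .vert 1 0, .slant 0 0, .vert 1 (-1), .vert 2 (-1), .vert 3 (-1),
  .vert 4 (-1), .vert 5 (-1), .vert 6 (-1), .slant 6 0, .slant 6 1, .slant 6 2, .slant 6 3, .vert 6 3, .vert 5 3,
  .vert 4 3, .vert 3 3, .slant 2 3]

/-- The witness as a walk of its block. [cite: GlazmanManolescu2019, §1 (definition of the model), Fig. 1] -/
def pairU3Walk : YBWalk (dom pairBlockU342) (w42.side .W) ((farW w42).side .N) where
  mids := pairU3Mids
  head_eq := by decide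
  getLast_eq := by decide
  nodup := by decide
  arc_mem := arc_mem_of_check (by decide)
  isChain := by decide
  noncross := noncross_of_check (by decide)

/-- The labelled witness. [cite: Glazman2015WeightedSAW, Lemma 3.1 (proof, pp. 6–7)] -/
def ωpairU3 : ΩG (dom pairBlockU342) (w42.side .W) (farW w42) := ⟨.N, pairU3Walk⟩

/-- Certificates: first hit `6`, `30` arcs, no later far-cell arc, first side `S`, `w₁`-free and `w₂`-free off the far
cell, odd eastern-ray count. [cite: Glazman2015WeightedSAW, Lemma 3.1 (proof, pp. 6–7)] [cite: CourantRobbins1958, Ch. V Appendix §2 (the even–odd rule)] -/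
theorem ωpairU3_cert : ωpairU3.2.firstHitG = 6 ∧ ωpairU3.2.arcs.length = 30 ∧
    (∀ j < 30, 6 < j → ωpairU3.2.fc j ≠ farW w42) ∧ ωpairU3.2.nth 6 = (farW w42).side .S ∧
    (ωpairU3.2.W1FreeOff (farW w42) ∧ ωpairU3.2.W2FreeOff (farW w42)) ∧
    Odd ((Finset.range 24).filter fun j => eastRayB w42 (ωpairU3.2.nth (6 + j + 1)) = true).card := by
  refine ⟨by decide, by decide, by decide, by decide, ⟨by unfold YBWalk.W1FreeOff; decide, by unfold YBWalk.W2FreeOff; decide⟩,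
    by decide⟩

/-- The block at the root plaquette `w`. [cite: GlazmanManolescu2019, §2.1, §4.2 (translation invariance)] -/
def pairBlockU3 (w : Face) : List Face := pairBlockU342.map (Face.shiftBy (refShift w))

/-- ★★★ The unmarked under wound witness `U3` at EVERY POSITION: any face list containing the translated block carries a
wound class-`B2a` under-walk at the far cell, `w₁`-free and `w₂`-free off it.
[cite: GlazmanManolescu2019, §4.2 (translation invariance), Lemma 2.1]
[cite: Glazman2015WeightedSAW, Lemma 3.1 (proof, pp. 6–7)] [cite: CourantRobbins1958, Ch. V Appendix §2 (the even–odd rule)] -/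
theorem exists_under_unmarked_of_pairBlockU3 {Dl : List Face} {w : Face} (hB : ∀ c ∈ pairBlockU3 w, c ∈ Dl)
    (hr : RootedFace (dom Dl) (w.side .W) (farW w)) (θ : ℝ) :
    ∃ (ω : ΩG (dom Dl) (w.side .W) (farW w)) (h : ω.IsB2a), ω.2.firstSideG = .S ∧
      ω.WE (fun _ => θ) ≠ excursionWinding θ ω.2.firstSideG (ω.z1 hr h) ω.1 ∧
        (ω.2.W1FreeOff (farW w) ∧ ω.2.W2FreeOff (farW w)) := by
  have hB₀ := block42_mem_of_block_mem (B := pairBlockU342) hB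
  obtain ⟨hF, hn, hfc, hnth, hfree, hodd⟩ := ωpairU3_cert
  let ω₀ : ΩG (dom (Dl.map (Face.shiftBy (-refShift w)))) (w42.side .W) (farW w42) :=
    ⟨.N, pairU3Walk.mapDomain fun c hc => hB₀ c hc⟩
  have hF' : ω₀.2.firstHitG = 6 := hF
  have hn' : ω₀.2.arcs.length = 30 := hn
  have h₀ : ω₀.IsB2a := by
    refine ΩG.isB2a_of_forall_fc_ne (by rw [hF', hn']; omega) fun j hj1 hj2 => ?_
    rw [hF'] at hj1
    rw [hn'] at hj2
    exact hfc j hj2 hj1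
  have hM : ω₀.Mv = 24 := by unfold ΩG.Mv; rw [hF', hn']
  exact exists_wound_witness_shift (shiftBy_refShift_root w) (shiftBy_refShift_farW w) hr
    (fun γ r => γ.W1FreeOff r ∧ γ.W2FreeOff r)
    (fun hm _ hf => ⟨YBWalk.W1FreeOff_of_mids_shift hm hf.1, YBWalk.W2FreeOff_of_mids_shift hm hf.2⟩) ω₀ h₀
    (by rw [hF']; exact hnth) hfree (by rw [hM, hF']; exact hodd) θ

/-- Pair-census witness block `U4`: the 32 cells of an under wound witness, UNMARKED (one arc per rhombus: `w₁`-free and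
`w₂`-free off the far cell), reference root `(4, 2)`, hole `(3, 2)`, far cell `(2, 2)`, cells in the frame `[0,6]×[−1,5]`, AVOIDING
`(2,0)`, `(2,4)`, `(4,1)` (covers 4 (pair, type) cells of kit j300087; constructive generator `wgen.py`, seat b-step0 gen 30).
[cite: GlazmanManolescu2019, §2.1 (finite domains of faces)] -/
def pairBlockU442 : List Face :=
  [(0,-1),(0,0),(0,1),(0,2),(0,3),(1,-1),(1,0),(1,1),(1,2),(1,3),(2,-1),(2,1),(2,2),(2,3),(3,-1),(3,0),(3,1),(3,3),
  (4,-1),(4,0),(4,2),(4,3),(5,-1),(5,0),(5,1),(5,2),(5,3),(6,-1),(6,0),(6,1),(6,2),(6,3)]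

/-- Its mid-edges (32 arcs). [cite: GlazmanManolescu2019, §1 (definition of the model), Fig. 1] -/
def pairU4Mids : List MidEdge :=
  [.vert 4 2, .vert 5 2, .slant 5 2, .slant 5 1, .vert 5 0, .vert 4 0, .slant 3 1, .vert 3 1, .slant 2 2, .vert 2 2,
  .slant 1 3, .vert 1 3, .slant 0 3, .slant 0 2, .vert 1 1, .slant 1 1, .vert 1 0, .slant 0 0, .vert 1 (-1),
  .vert 2 (-1), .vert 3 (-1), .vert 4 (-1), .vert 5 (-1), .vert 6 (-1), .slant 6 0, .slant 6 1, .slant 6 2, .slant 6 3,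
  .vert 6 3, .vert 5 3, .vert 4 3, .vert 3 3, .slant 2 3]

/-- The witness as a walk of its block. [cite: GlazmanManolescu2019, §1 (definition of the model), Fig. 1] -/
def pairU4Walk : YBWalk (dom pairBlockU442) (w42.side .W) ((farW w42).side .N) where
  mids := pairU4Mids
  head_eq := by decide
  getLast_eq := by decide
  nodup := by decide
  arc_mem := arc_mem_of_check (by decide)
  isChain := by decide
  noncross := noncross_of_check (by decide)

/-- The labelled witness. [cite: Glazman2015WeightedSAW, Lemma 3.1 (proof, pp. 6–7)] -/
def ωpairU4 : ΩG (dom pairBlockU442) (w42.side .W) (farW w42) := ⟨.N, pairU4Walk⟩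

/-- Certificates: first hit `8`, `32` arcs, no later far-cell arc, first side `S`, `w₁`-free and `w₂`-free off the far
cell, odd eastern-ray count. [cite: Glazman2015WeightedSAW, Lemma 3.1 (proof, pp. 6–7)] [cite: CourantRobbins1958, Ch. V Appendix §2 (the even–odd rule)] -/
theorem ωpairU4_cert : ωpairU4.2.firstHitG = 8 ∧ ωpairU4.2.arcs.length = 32 ∧
    (∀ j < 32, 8 < j → ωpairU4.2.fc j ≠ farW w42) ∧ ωpairU4.2.nth 8 = (farW w42).side .S ∧
    (ωpairU4.2.W1FreeOff (farW w42) ∧ ωpairU4.2.W2FreeOff (farW w42)) ∧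
    Odd ((Finset.range 24).filter fun j => eastRayB w42 (ωpairU4.2.nth (8 + j + 1)) = true).card := by
  refine ⟨by decide, by decide, by decide, by decide, ⟨by unfold YBWalk.W1FreeOff; decide, by unfold YBWalk.W2FreeOff; decide⟩,
    by decide⟩

/-- The block at the root plaquette `w`. [cite: GlazmanManolescu2019, §2.1, §4.2 (translation invariance)] -/
def pairBlockU4 (w : Face) : List Face := pairBlockU442.map (Face.shiftBy (refShift w))

/-- ★★★ The unmarked under wound witness `U4` at EVERY POSITION: any face list containing the translated block carries a
wound class-`B2a` under-walk at the far cell, `w₁`-free and `w₂`-free off it.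
[cite: GlazmanManolescu2019, §4.2 (translation invariance), Lemma 2.1]
[cite: Glazman2015WeightedSAW, Lemma 3.1 (proof, pp. 6–7)] [cite: CourantRobbins1958, Ch. V Appendix §2 (the even–odd rule)] -/
theorem exists_under_unmarked_of_pairBlockU4 {Dl : List Face} {w : Face} (hB : ∀ c ∈ pairBlockU4 w, c ∈ Dl)
    (hr : RootedFace (dom Dl) (w.side .W) (farW w)) (θ : ℝ) :
    ∃ (ω : ΩG (dom Dl) (w.side .W) (farW w)) (h : ω.IsB2a), ω.2.firstSideG = .S ∧
      ω.WE (fun _ => θ) ≠ excursionWinding θ ω.2.firstSideG (ω.z1 hr h) ω.1 ∧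
        (ω.2.W1FreeOff (farW w) ∧ ω.2.W2FreeOff (farW w)) := by
  have hB₀ := block42_mem_of_block_mem (B := pairBlockU442) hB
  obtain ⟨hF, hn, hfc, hnth, hfree, hodd⟩ := ωpairU4_cert
  let ω₀ : ΩG (dom (Dl.map (Face.shiftBy (-refShift w)))) (w42.side .W) (farW w42) :=
    ⟨.N, pairU4Walk.mapDomain fun c hc => hB₀ c hc⟩
  have hF' : ω₀.2.firstHitG = 8 := hF
  have hn' : ω₀.2.arcs.length = 32 := hn
  have h₀ : ω₀.IsB2a := by
    refine ΩG.isB2a_of_forall_fc_ne (by rw [hF', hn']; omega) fun j hj1 hj2 => ?_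
    rw [hF'] at hj1
    rw [hn'] at hj2
    exact hfc j hj2 hj1
  have hM : ω₀.Mv = 24 := by unfold ΩG.Mv; rw [hF', hn']
  exact exists_wound_witness_shift (shiftBy_refShift_root w) (shiftBy_refShift_farW w) hr
    (fun γ r => γ.W1FreeOff r ∧ γ.W2FreeOff r)
    (fun hm _ hf => ⟨YBWalk.W1FreeOff_of_mids_shift hm hf.1, YBWalk.W2FreeOff_of_mids_shift hm hf.2⟩) ω₀ h₀
    (by rw [hF']; exact hnth) hfree (by rw [hM, hF']; exact hodd) θ

/-- Pair-census witness block `O1`: the 34 cells of an over wound witness, UNMARKED (one arc per rhombus: `w₁`-free and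
`w₂`-free off the far cell), reference root `(4, 2)`, hole `(3, 2)`, far cell `(2, 2)`, cells in the frame `[0,6]×[−1,5]`, AVOIDING
`(1,0)`, `(1,3)`, `(1,4)`, `(2,0)`, `(3,0)`, `(3,1)`, `(3,3)`, `(4,0)`, `(4,1)`, `(5,0)`, `(5,1)`, `(5,2)`, `(5,3)`, `(5,4)` (covers 66 (pair, type) cells of kit j300087; constructive generator `wgen.py`, seat b-step0 gen 30).
[cite: GlazmanManolescu2019, §2.1 (finite domains of faces)] -/
def pairBlockO142 : List Face :=
  [(0,-1),(0,0),(0,1),(0,2),(0,3),(0,4),(0,5),(1,-1),(1,1),(1,2),(1,5),(2,-1),(2,1),(2,2),(2,3),(2,4),(2,5),(3,-1),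
  (3,4),(3,5),(4,-1),(4,2),(4,3),(4,4),(4,5),(5,-1),(5,5),(6,-1),(6,0),(6,1),(6,2),(6,3),(6,4),(6,5)]

/-- Its mid-edges (34 arcs). [cite: GlazmanManolescu2019, §1 (definition of the model), Fig. 1] -/
def pairO1Mids : List MidEdge :=
  [.vert 4 2, .slant 4 3, .slant 4 4, .vert 4 4, .vert 3 4, .slant 2 4, .slant 2 3, .vert 2 2, .vert 1 2, .slant 0 3,
  .slant 0 4, .slant 0 5, .vert 1 5, .vert 2 5, .vert 3 5, .vert 4 5, .vert 5 5, .vert 6 5, .slant 6 5, .slant 6 4,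
  .slant 6 3, .slant 6 2, .slant 6 1, .slant 6 0, .vert 6 (-1), .vert 5 (-1), .vert 4 (-1), .vert 3 (-1), .vert 2 (-1),
  .vert 1 (-1), .slant 0 0, .slant 0 1, .vert 1 1, .vert 2 1, .slant 2 2]

/-- The witness as a walk of its block. [cite: GlazmanManolescu2019, §1 (definition of the model), Fig. 1] -/
def pairO1Walk : YBWalk (dom pairBlockO142) (w42.side .W) ((farW w42).side .S) where
  mids := pairO1Mids
  head_eq := by decide
  getLast_eq := by decide
  nodup := by decide
  arc_mem := arc_mem_of_check (by decide)
  isChain := by decide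
  noncross := noncross_of_check (by decide)

/-- The labelled witness. [cite: Glazman2015WeightedSAW, Lemma 3.1 (proof, pp. 6–7)] -/
def ωpairO1 : ΩG (dom pairBlockO142) (w42.side .W) (farW w42) := ⟨.S, pairO1Walk⟩

/-- Certificates: first hit `6`, `34` arcs, no later far-cell arc, first side `N`, `w₁`-free and `w₂`-free off the far
cell, odd eastern-ray count. [cite: Glazman2015WeightedSAW, Lemma 3.1 (proof, pp. 6–7)] [cite: CourantRobbins1958, Ch. V Appendix §2 (the even–odd rule)] -/
theorem ωpairO1_cert : ωpairO1.2.firstHitG = 6 ∧ ωpairO1.2.arcs.length = 34 ∧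
    (∀ j < 34, 6 < j → ωpairO1.2.fc j ≠ farW w42) ∧ ωpairO1.2.nth 6 = (farW w42).side .N ∧
    (ωpairO1.2.W1FreeOff (farW w42) ∧ ωpairO1.2.W2FreeOff (farW w42)) ∧
    Odd ((Finset.range 28).filter fun j => eastRayB w42 (ωpairO1.2.nth (6 + j + 1)) = true).card := by
  refine ⟨by decide, by decide, by decide, by decide, ⟨by unfold YBWalk.W1FreeOff; decide, by unfold YBWalk.W2FreeOff; decide⟩,
    by decide⟩

/-- The block at the root plaquette `w`. [cite: GlazmanManolescu2019, §2.1, §4.2 (translation invariance)] -/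
def pairBlockO1 (w : Face) : List Face := pairBlockO142.map (Face.shiftBy (refShift w))

/-- ★★★ The unmarked over wound witness `O1` at EVERY POSITION: any face list containing the translated block carries a
wound class-`B2a` over-walk at the far cell, `w₁`-free and `w₂`-free off it.
[cite: GlazmanManolescu2019, §4.2 (translation invariance), Lemma 2.1]
[cite: Glazman2015WeightedSAW, Lemma 3.1 (proof, pp. 6–7)] [cite: CourantRobbins1958, Ch. V Appendix §2 (the even–odd rule)] -/
theorem exists_over_unmarked_of_pairBlockO1 {Dl : List Face} {w : Face} (hB : ∀ c ∈ pairBlockO1 w, c ∈ Dl)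
    (hr : RootedFace (dom Dl) (w.side .W) (farW w)) (θ : ℝ) :
    ∃ (ω : ΩG (dom Dl) (w.side .W) (farW w)) (h : ω.IsB2a), ω.2.firstSideG = .N ∧
      ω.WE (fun _ => θ) ≠ excursionWinding θ ω.2.firstSideG (ω.z1 hr h) ω.1 ∧
        (ω.2.W1FreeOff (farW w) ∧ ω.2.W2FreeOff (farW w)) := by
  have hB₀ := block42_mem_of_block_mem (B := pairBlockO142) hB
  obtain ⟨hF, hn, hfc, hnth, hfree, hodd⟩ := ωpairO1_cert
  let ω₀ : ΩG (dom (Dl.map (Face.shiftBy (-refShift w)))) (w42.side .W) (farW w42) :=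
    ⟨.S, pairO1Walk.mapDomain fun c hc => hB₀ c hc⟩
  have hF' : ω₀.2.firstHitG = 6 := hF
  have hn' : ω₀.2.arcs.length = 34 := hn
  have h₀ : ω₀.IsB2a := by
    refine ΩG.isB2a_of_forall_fc_ne (by rw [hF', hn']; omega) fun j hj1 hj2 => ?_
    rw [hF'] at hj1
    rw [hn'] at hj2
    exact hfc j hj2 hj1
  have hM : ω₀.Mv = 28 := by unfold ΩG.Mv; rw [hF', hn']
  exact exists_wound_witness_shift (shiftBy_refShift_root w) (shiftBy_refShift_farW w) hr
    (fun γ r => γ.W1FreeOff r ∧ γ.W2FreeOff r)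
    (fun hm _ hf => ⟨YBWalk.W1FreeOff_of_mids_shift hm hf.1, YBWalk.W2FreeOff_of_mids_shift hm hf.2⟩) ω₀ h₀
    (by rw [hF']; exact hnth) hfree (by rw [hM, hF']; exact hodd) θ

/-- Pair-census witness block `O2`: the 32 cells of an over wound witness, UNMARKED (one arc per rhombus: `w₁`-free and
`w₂`-free off the far cell), reference root `(4, 2)`, hole `(3, 2)`, far cell `(2, 2)`, cells in the frame `[0,6]×[−1,5]`, AVOIDING
`(1,0)`, `(1,1)`, `(1,3)`, `(1,4)`, `(2,4)`, `(3,0)`, `(3,1)`, `(4,0)`, `(4,1)`, `(4,3)`, `(5,0)`, `(5,1)` (covers 26 (pair, type) cells of kit j300087; constructive generator `wgen.py`, seat b-step0 gen 30).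
[cite: GlazmanManolescu2019, §2.1 (finite domains of faces)] -/
def pairBlockO242 : List Face :=
  [(0,2),(0,3),(0,4),(0,5),(1,2),(1,5),(2,-1),(2,0),(2,1),(2,2),(2,3),(2,5),(3,-1),(3,3),(3,4),(3,5),(4,-1),(4,2),(4,4),
  (4,5),(5,-1),(5,2),(5,3),(5,4),(5,5),(6,-1),(6,0),(6,1),(6,2),(6,3),(6,4),(6,5)]

/-- Its mid-edges (32 arcs). [cite: GlazmanManolescu2019, §1 (definition of the model), Fig. 1] -/
def pairO2Mids : List MidEdge :=
  [.vert 4 2, .vert 5 2, .slant 5 3, .slant 5 4, .vert 5 4, .vert 4 4, .slant 3 4, .vert 3 3, .slant 2 3, .vert 2 2,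
  .vert 1 2, .slant 0 3, .slant 0 4, .slant 0 5, .vert 1 5, .vert 2 5, .vert 3 5, .vert 4 5, .vert 5 5, .vert 6 5,
  .slant 6 5, .slant 6 4, .slant 6 3, .slant 6 2, .slant 6 1, .slant 6 0, .vert 6 (-1), .vert 5 (-1), .vert 4 (-1),
  .vert 3 (-1), .slant 2 0, .slant 2 1, .slant 2 2]

/-- The witness as a walk of its block. [cite: GlazmanManolescu2019, §1 (definition of the model), Fig. 1] -/
def pairO2Walk : YBWalk (dom pairBlockO242) (w42.side .W) ((farW w42).side .S) where
  mids := pairO2Mids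
  head_eq := by decide
  getLast_eq := by decide
  nodup := by decide
  arc_mem := arc_mem_of_check (by decide)
  isChain := by decide
  noncross := noncross_of_check (by decide)

/-- The labelled witness. [cite: Glazman2015WeightedSAW, Lemma 3.1 (proof, pp. 6–7)] -/
def ωpairO2 : ΩG (dom pairBlockO242) (w42.side .W) (farW w42) := ⟨.S, pairO2Walk⟩

/-- Certificates: first hit `8`, `32` arcs, no later far-cell arc, first side `N`, `w₁`-free and `w₂`-free off the far
cell, odd eastern-ray count. [cite: Glazman2015WeightedSAW, Lemma 3.1 (proof, pp. 6–7)] [cite: CourantRobbins1958, Ch. V Appendix §2 (the even–odd rule)] -/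
theorem ωpairO2_cert : ωpairO2.2.firstHitG = 8 ∧ ωpairO2.2.arcs.length = 32 ∧
    (∀ j < 32, 8 < j → ωpairO2.2.fc j ≠ farW w42) ∧ ωpairO2.2.nth 8 = (farW w42).side .N ∧
    (ωpairO2.2.W1FreeOff (farW w42) ∧ ωpairO2.2.W2FreeOff (farW w42)) ∧
    Odd ((Finset.range 24).filter fun j => eastRayB w42 (ωpairO2.2.nth (8 + j + 1)) = true).card := by
  refine ⟨by decide, by decide, by decide, by decide, ⟨by unfold YBWalk.W1FreeOff; decide, by unfold YBWalk.W2FreeOff; decide⟩,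
    by decide⟩

/-- The block at the root plaquette `w`. [cite: GlazmanManolescu2019, §2.1, §4.2 (translation invariance)] -/
def pairBlockO2 (w : Face) : List Face := pairBlockO242.map (Face.shiftBy (refShift w))

/-- ★★★ The unmarked over wound witness `O2` at EVERY POSITION: any face list containing the translated block carries a
wound class-`B2a` over-walk at the far cell, `w₁`-free and `w₂`-free off it.
[cite: GlazmanManolescu2019, §4.2 (translation invariance), Lemma 2.1]
[cite: Glazman2015WeightedSAW, Lemma 3.1 (proof, pp. 6–7)] [cite: CourantRobbins1958, Ch. V Appendix §2 (the even–odd rule)] -/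
theorem exists_over_unmarked_of_pairBlockO2 {Dl : List Face} {w : Face} (hB : ∀ c ∈ pairBlockO2 w, c ∈ Dl)
    (hr : RootedFace (dom Dl) (w.side .W) (farW w)) (θ : ℝ) :
    ∃ (ω : ΩG (dom Dl) (w.side .W) (farW w)) (h : ω.IsB2a), ω.2.firstSideG = .N ∧
      ω.WE (fun _ => θ) ≠ excursionWinding θ ω.2.firstSideG (ω.z1 hr h) ω.1 ∧
        (ω.2.W1FreeOff (farW w) ∧ ω.2.W2FreeOff (farW w)) := by
  have hB₀ := block42_mem_of_block_mem (B := pairBlockO242) hB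
  obtain ⟨hF, hn, hfc, hnth, hfree, hodd⟩ := ωpairO2_cert
  let ω₀ : ΩG (dom (Dl.map (Face.shiftBy (-refShift w)))) (w42.side .W) (farW w42) :=
    ⟨.S, pairO2Walk.mapDomain fun c hc => hB₀ c hc⟩
  have hF' : ω₀.2.firstHitG = 8 := hF
  have hn' : ω₀.2.arcs.length = 32 := hn
  have h₀ : ω₀.IsB2a := by
    refine ΩG.isB2a_of_forall_fc_ne (by rw [hF', hn']; omega) fun j hj1 hj2 => ?_
    rw [hF'] at hj1
    rw [hn'] at hj2
    exact hfc j hj2 hj1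
  have hM : ω₀.Mv = 24 := by unfold ΩG.Mv; rw [hF', hn']
  exact exists_wound_witness_shift (shiftBy_refShift_root w) (shiftBy_refShift_farW w) hr
    (fun γ r => γ.W1FreeOff r ∧ γ.W2FreeOff r)
    (fun hm _ hf => ⟨YBWalk.W1FreeOff_of_mids_shift hm hf.1, YBWalk.W2FreeOff_of_mids_shift hm hf.2⟩) ω₀ h₀
    (by rw [hF']; exact hnth) hfree (by rw [hM, hF']; exact hodd) θ

/-- Pair-census witness block `O3`: the 34 cells of an over wound witness, UNMARKED (one arc per rhombus: `w₁`-free and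
`w₂`-free off the far cell), reference root `(4, 2)`, hole `(3, 2)`, far cell `(2, 2)`, cells in the frame `[0,6]×[−1,5]`, AVOIDING
`(3,1)`, `(4,1)`, `(4,4)` (covers 4 (pair, type) cells of kit j300087; constructive generator `wgen.py`, seat b-step0 gen 30).
[cite: GlazmanManolescu2019, §2.1 (finite domains of faces)] -/
def pairBlockO342 : List Face :=
  [(0,1),(0,2),(0,3),(0,4),(0,5),(1,1),(1,2),(1,3),(1,4),(1,5),(2,0),(2,1),(2,2),(2,3),(2,4),(2,5),(3,0),(3,3),(3,4),
  (3,5),(4,0),(4,2),(4,3),(4,5),(5,0),(5,1),(5,2),(5,3),(5,4),(5,5),(6,1),(6,2),(6,3),(6,4)]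

/-- Its mid-edges (34 arcs). [cite: GlazmanManolescu2019, §1 (definition of the model), Fig. 1] -/
def pairO3Mids : List MidEdge :=
  [.vert 4 2, .vert 5 2, .slant 5 3, .vert 5 3, .vert 4 3, .slant 3 4, .vert 3 4, .slant 2 4, .slant 2 3, .vert 2 2,
  .slant 1 2, .vert 1 1, .slant 0 2, .slant 0 3, .vert 1 3, .slant 1 4, .vert 1 4, .slant 0 5, .vert 1 5, .vert 2 5,
  .vert 3 5, .vert 4 5, .vert 5 5, .slant 5 5, .vert 6 4, .slant 6 4, .slant 6 3, .slant 6 2, .vert 6 1, .slant 5 1,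
  .vert 5 0, .vert 4 0, .vert 3 0, .slant 2 1, .slant 2 2]

/-- The witness as a walk of its block. [cite: GlazmanManolescu2019, §1 (definition of the model), Fig. 1] -/
def pairO3Walk : YBWalk (dom pairBlockO342) (w42.side .W) ((farW w42).side .S) where
  mids := pairO3Mids
  head_eq := by decide
  getLast_eq := by decide
  nodup := by decide
  arc_mem := arc_mem_of_check (by decide)
  isChain := by decide
  noncross := noncross_of_check (by decide)

/-- The labelled witness. [cite: Glazman2015WeightedSAW, Lemma 3.1 (proof, pp. 6–7)] -/
def ωpairO3 : ΩG (dom pairBlockO342) (w42.side .W) (farW w42) := ⟨.S, pairO3Walk⟩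

/-- Certificates: first hit `8`, `34` arcs, no later far-cell arc, first side `N`, `w₁`-free and `w₂`-free off the far
cell, odd eastern-ray count. [cite: Glazman2015WeightedSAW, Lemma 3.1 (proof, pp. 6–7)] [cite: CourantRobbins1958, Ch. V Appendix §2 (the even–odd rule)] -/
theorem ωpairO3_cert : ωpairO3.2.firstHitG = 8 ∧ ωpairO3.2.arcs.length = 34 ∧
    (∀ j < 34, 8 < j → ωpairO3.2.fc j ≠ farW w42) ∧ ωpairO3.2.nth 8 = (farW w42).side .N ∧
    (ωpairO3.2.W1FreeOff (farW w42) ∧ ωpairO3.2.W2FreeOff (farW w42)) ∧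
    Odd ((Finset.range 26).filter fun j => eastRayB w42 (ωpairO3.2.nth (8 + j + 1)) = true).card := by
  refine ⟨by decide, by decide, by decide, by decide, ⟨by unfold YBWalk.W1FreeOff; decide, by unfold YBWalk.W2FreeOff; decide⟩,
    by decide⟩

/-- The block at the root plaquette `w`. [cite: GlazmanManolescu2019, §2.1, §4.2 (translation invariance)] -/
def pairBlockO3 (w : Face) : List Face := pairBlockO342.map (Face.shiftBy (refShift w))

/-- ★★★ The unmarked over wound witness `O3` at EVERY POSITION: any face list containing the translated block carries a
wound class-`B2a` over-walk at the far cell, `w₁`-free and `w₂`-free off it.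
[cite: GlazmanManolescu2019, §4.2 (translation invariance), Lemma 2.1]
[cite: Glazman2015WeightedSAW, Lemma 3.1 (proof, pp. 6–7)] [cite: CourantRobbins1958, Ch. V Appendix §2 (the even–odd rule)] -/
theorem exists_over_unmarked_of_pairBlockO3 {Dl : List Face} {w : Face} (hB : ∀ c ∈ pairBlockO3 w, c ∈ Dl)
    (hr : RootedFace (dom Dl) (w.side .W) (farW w)) (θ : ℝ) :
    ∃ (ω : ΩG (dom Dl) (w.side .W) (farW w)) (h : ω.IsB2a), ω.2.firstSideG = .N ∧
      ω.WE (fun _ => θ) ≠ excursionWinding θ ω.2.firstSideG (ω.z1 hr h) ω.1 ∧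
        (ω.2.W1FreeOff (farW w) ∧ ω.2.W2FreeOff (farW w)) := by
  have hB₀ := block42_mem_of_block_mem (B := pairBlockO342) hB
  obtain ⟨hF, hn, hfc, hnth, hfree, hodd⟩ := ωpairO3_cert
  let ω₀ : ΩG (dom (Dl.map (Face.shiftBy (-refShift w)))) (w42.side .W) (farW w42) :=
    ⟨.S, pairO3Walk.mapDomain fun c hc => hB₀ c hc⟩
  have hF' : ω₀.2.firstHitG = 8 := hF
  have hn' : ω₀.2.arcs.length = 34 := hn
  have h₀ : ω₀.IsB2a := by
    refine ΩG.isB2a_of_forall_fc_ne (by rw [hF', hn']; omega) fun j hj1 hj2 => ?_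
    rw [hF'] at hj1
    rw [hn'] at hj2
    exact hfc j hj2 hj1
  have hM : ω₀.Mv = 26 := by unfold ΩG.Mv; rw [hF', hn']
  exact exists_wound_witness_shift (shiftBy_refShift_root w) (shiftBy_refShift_farW w) hr
    (fun γ r => γ.W1FreeOff r ∧ γ.W2FreeOff r)
    (fun hm _ hf => ⟨YBWalk.W1FreeOff_of_mids_shift hm hf.1, YBWalk.W2FreeOff_of_mids_shift hm hf.2⟩) ω₀ h₀
    (by rw [hF']; exact hnth) hfree (by rw [hM, hF']; exact hodd) θ

/-- Pair-census witness block `O4`: the 34 cells of an over wound witness, UNMARKED (one arc per rhombus: `w₁`-free and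
`w₂`-free off the far cell), reference root `(4, 2)`, hole `(3, 2)`, far cell `(2, 2)`, cells in the frame `[0,6]×[−1,5]`, AVOIDING
`(3,1)`, `(3,4)`, `(4,1)` (covers 4 (pair, type) cells of kit j300087; constructive generator `wgen.py`, seat b-step0 gen 30).
[cite: GlazmanManolescu2019, §2.1 (finite domains of faces)] -/
def pairBlockO442 : List Face :=
  [(0,1),(0,2),(0,3),(0,4),(0,5),(1,1),(1,2),(1,3),(1,4),(1,5),(2,0),(2,1),(2,2),(2,3),(2,5),(3,0),(3,3),(3,5),(4,0),
  (4,2),(4,3),(4,4),(4,5),(5,0),(5,1),(5,2),(5,3),(5,4),(5,5),(6,1),(6,2),(6,3),(6,4),(6,5)]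

/-- Its mid-edges (34 arcs). [cite: GlazmanManolescu2019, §1 (definition of the model), Fig. 1] -/
def pairO4Mids : List MidEdge :=
  [.vert 4 2, .vert 5 2, .slant 5 3, .slant 5 4, .vert 5 4, .slant 4 4, .vert 4 3, .vert 3 3, .slant 2 3, .vert 2 2,
  .slant 1 2, .vert 1 1, .slant 0 2, .slant 0 3, .vert 1 3, .slant 1 4, .vert 1 4, .slant 0 5, .vert 1 5, .vert 2 5,
  .vert 3 5, .vert 4 5, .vert 5 5, .vert 6 5, .slant 6 5, .slant 6 4, .slant 6 3, .slant 6 2, .vert 6 1, .slant 5 1,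
  .vert 5 0, .vert 4 0, .vert 3 0, .slant 2 1, .slant 2 2]

/-- The witness as a walk of its block. [cite: GlazmanManolescu2019, §1 (definition of the model), Fig. 1] -/
def pairO4Walk : YBWalk (dom pairBlockO442) (w42.side .W) ((farW w42).side .S) where
  mids := pairO4Mids
  head_eq := by decide
  getLast_eq := by decide
  nodup := by decide
  arc_mem := arc_mem_of_check (by decide)
  isChain := by decide
  noncross := noncross_of_check (by decide)

/-- The labelled witness. [cite: Glazman2015WeightedSAW, Lemma 3.1 (proof, pp. 6–7)] -/
def ωpairO4 : ΩG (dom pairBlockO442) (w42.side .W) (farW w42) := ⟨.S, pairO4Walk⟩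

/-- Certificates: first hit `8`, `34` arcs, no later far-cell arc, first side `N`, `w₁`-free and `w₂`-free off the far
cell, odd eastern-ray count. [cite: Glazman2015WeightedSAW, Lemma 3.1 (proof, pp. 6–7)] [cite: CourantRobbins1958, Ch. V Appendix §2 (the even–odd rule)] -/
theorem ωpairO4_cert : ωpairO4.2.firstHitG = 8 ∧ ωpairO4.2.arcs.length = 34 ∧
    (∀ j < 34, 8 < j → ωpairO4.2.fc j ≠ farW w42) ∧ ωpairO4.2.nth 8 = (farW w42).side .N ∧
    (ωpairO4.2.W1FreeOff (farW w42) ∧ ωpairO4.2.W2FreeOff (farW w42)) ∧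
    Odd ((Finset.range 26).filter fun j => eastRayB w42 (ωpairO4.2.nth (8 + j + 1)) = true).card := by
  refine ⟨by decide, by decide, by decide, by decide, ⟨by unfold YBWalk.W1FreeOff; decide, by unfold YBWalk.W2FreeOff; decide⟩,
    by decide⟩

/-- The block at the root plaquette `w`. [cite: GlazmanManolescu2019, §2.1, §4.2 (translation invariance)] -/
def pairBlockO4 (w : Face) : List Face := pairBlockO442.map (Face.shiftBy (refShift w))

/-- ★★★ The unmarked over wound witness `O4` at EVERY POSITION: any face list containing the translated block carries a
wound class-`B2a` over-walk at the far cell, `w₁`-free and `w₂`-free off it.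
[cite: GlazmanManolescu2019, §4.2 (translation invariance), Lemma 2.1]
[cite: Glazman2015WeightedSAW, Lemma 3.1 (proof, pp. 6–7)] [cite: CourantRobbins1958, Ch. V Appendix §2 (the even–odd rule)] -/
theorem exists_over_unmarked_of_pairBlockO4 {Dl : List Face} {w : Face} (hB : ∀ c ∈ pairBlockO4 w, c ∈ Dl)
    (hr : RootedFace (dom Dl) (w.side .W) (farW w)) (θ : ℝ) :
    ∃ (ω : ΩG (dom Dl) (w.side .W) (farW w)) (h : ω.IsB2a), ω.2.firstSideG = .N ∧
      ω.WE (fun _ => θ) ≠ excursionWinding θ ω.2.firstSideG (ω.z1 hr h) ω.1 ∧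
        (ω.2.W1FreeOff (farW w) ∧ ω.2.W2FreeOff (farW w)) := by
  have hB₀ := block42_mem_of_block_mem (B := pairBlockO442) hB
  obtain ⟨hF, hn, hfc, hnth, hfree, hodd⟩ := ωpairO4_cert
  let ω₀ : ΩG (dom (Dl.map (Face.shiftBy (-refShift w)))) (w42.side .W) (farW w42) :=
    ⟨.S, pairO4Walk.mapDomain fun c hc => hB₀ c hc⟩
  have hF' : ω₀.2.firstHitG = 8 := hF
  have hn' : ω₀.2.arcs.length = 34 := hn
  have h₀ : ω₀.IsB2a := by
    refine ΩG.isB2a_of_forall_fc_ne (by rw [hF', hn']; omega) fun j hj1 hj2 => ?_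
    rw [hF'] at hj1
    rw [hn'] at hj2
    exact hfc j hj2 hj1
  have hM : ω₀.Mv = 26 := by unfold ΩG.Mv; rw [hF', hn']
  exact exists_wound_witness_shift (shiftBy_refShift_root w) (shiftBy_refShift_farW w) hr
    (fun γ r => γ.W1FreeOff r ∧ γ.W2FreeOff r)
    (fun hm _ hf => ⟨YBWalk.W1FreeOff_of_mids_shift hm hf.1, YBWalk.W2FreeOff_of_mids_shift hm hf.2⟩) ω₀ h₀
    (by rw [hF']; exact hnth) hfree (by rw [hM, hF']; exact hodd) θ

/-- Pair-census witness block `O5`: the 28 cells of an over wound witness, UNMARKED (one arc per rhombus: `w₁`-free and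
`w₂`-free off the far cell), reference root `(4, 2)`, hole `(3, 2)`, far cell `(2, 2)`, cells in the frame `[0,6]×[−1,5]`, AVOIDING
`(1,1)`, `(2,0)`, `(3,3)`, `(4,3)` (covers 4 (pair, type) cells of kit j300087; constructive generator `wgen.py`, seat b-step0 gen 30).
[cite: GlazmanManolescu2019, §2.1 (finite domains of faces)] -/
def pairBlockO542 : List Face :=
  [(0,2),(0,3),(0,4),(0,5),(1,2),(1,5),(2,1),(2,2),(2,3),(2,4),(2,5),(3,1),(3,4),(3,5),(4,1),(4,2),(4,4),(4,5),(5,1),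
  (5,2),(5,3),(5,4),(5,5),(6,1),(6,2),(6,3),(6,4),(6,5)]

/-- Its mid-edges (28 arcs). [cite: GlazmanManolescu2019, §1 (definition of the model), Fig. 1] -/
def pairO5Mids : List MidEdge :=
  [.vert 4 2, .vert 5 2, .slant 5 3, .slant 5 4, .vert 5 4, .vert 4 4, .vert 3 4, .slant 2 4, .slant 2 3, .vert 2 2,
  .vert 1 2, .slant 0 3, .slant 0 4, .slant 0 5, .vert 1 5, .vert 2 5, .vert 3 5, .vert 4 5, .vert 5 5, .vert 6 5,
  .slant 6 5, .slant 6 4, .slant 6 3, .slant 6 2, .vert 6 1, .vert 5 1, .vert 4 1, .vert 3 1, .slant 2 2]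

/-- The witness as a walk of its block. [cite: GlazmanManolescu2019, §1 (definition of the model), Fig. 1] -/
def pairO5Walk : YBWalk (dom pairBlockO542) (w42.side .W) ((farW w42).side .S) where
  mids := pairO5Mids
  head_eq := by decide
  getLast_eq := by decide
  nodup := by decide
  arc_mem := arc_mem_of_check (by decide)
  isChain := by decide
  noncross := noncross_of_check (by decide)

/-- The labelled witness. [cite: Glazman2015WeightedSAW, Lemma 3.1 (proof, pp. 6–7)] -/
def ωpairO5 : ΩG (dom pairBlockO542) (w42.side .W) (farW w42) := ⟨.S, pairO5Walk⟩

/-- Certificates: first hit `8`, `28` arcs, no later far-cell arc, first side `N`, `w₁`-free and `w₂`-free off the far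
cell, odd eastern-ray count. [cite: Glazman2015WeightedSAW, Lemma 3.1 (proof, pp. 6–7)] [cite: CourantRobbins1958, Ch. V Appendix §2 (the even–odd rule)] -/
theorem ωpairO5_cert : ωpairO5.2.firstHitG = 8 ∧ ωpairO5.2.arcs.length = 28 ∧
    (∀ j < 28, 8 < j → ωpairO5.2.fc j ≠ farW w42) ∧ ωpairO5.2.nth 8 = (farW w42).side .N ∧
    (ωpairO5.2.W1FreeOff (farW w42) ∧ ωpairO5.2.W2FreeOff (farW w42)) ∧
    Odd ((Finset.range 20).filter fun j => eastRayB w42 (ωpairO5.2.nth (8 + j + 1)) = true).card := by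
  refine ⟨by decide, by decide, by decide, by decide, ⟨by unfold YBWalk.W1FreeOff; decide, by unfold YBWalk.W2FreeOff; decide⟩,
    by decide⟩

/-- The block at the root plaquette `w`. [cite: GlazmanManolescu2019, §2.1, §4.2 (translation invariance)] -/
def pairBlockO5 (w : Face) : List Face := pairBlockO542.map (Face.shiftBy (refShift w))

/-- ★★★ The unmarked over wound witness `O5` at EVERY POSITION: any face list containing the translated block carries a
wound class-`B2a` over-walk at the far cell, `w₁`-free and `w₂`-free off it.
[cite: GlazmanManolescu2019, §4.2 (translation invariance), Lemma 2.1]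
[cite: Glazman2015WeightedSAW, Lemma 3.1 (proof, pp. 6–7)] [cite: CourantRobbins1958, Ch. V Appendix §2 (the even–odd rule)] -/
theorem exists_over_unmarked_of_pairBlockO5 {Dl : List Face} {w : Face} (hB : ∀ c ∈ pairBlockO5 w, c ∈ Dl)
    (hr : RootedFace (dom Dl) (w.side .W) (farW w)) (θ : ℝ) :
    ∃ (ω : ΩG (dom Dl) (w.side .W) (farW w)) (h : ω.IsB2a), ω.2.firstSideG = .N ∧
      ω.WE (fun _ => θ) ≠ excursionWinding θ ω.2.firstSideG (ω.z1 hr h) ω.1 ∧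
        (ω.2.W1FreeOff (farW w) ∧ ω.2.W2FreeOff (farW w)) := by
  have hB₀ := block42_mem_of_block_mem (B := pairBlockO542) hB
  obtain ⟨hF, hn, hfc, hnth, hfree, hodd⟩ := ωpairO5_cert
  let ω₀ : ΩG (dom (Dl.map (Face.shiftBy (-refShift w)))) (w42.side .W) (farW w42) :=
    ⟨.S, pairO5Walk.mapDomain fun c hc => hB₀ c hc⟩
  have hF' : ω₀.2.firstHitG = 8 := hF
  have hn' : ω₀.2.arcs.length = 28 := hn
  have h₀ : ω₀.IsB2a := by
    refine ΩG.isB2a_of_forall_fc_ne (by rw [hF', hn']; omega) fun j hj1 hj2 => ?_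
    rw [hF'] at hj1
    rw [hn'] at hj2
    exact hfc j hj2 hj1
  have hM : ω₀.Mv = 20 := by unfold ΩG.Mv; rw [hF', hn']
  exact exists_wound_witness_shift (shiftBy_refShift_root w) (shiftBy_refShift_farW w) hr
    (fun γ r => γ.W1FreeOff r ∧ γ.W2FreeOff r)
    (fun hm _ hf => ⟨YBWalk.W1FreeOff_of_mids_shift hm hf.1, YBWalk.W2FreeOff_of_mids_shift hm hf.2⟩) ω₀ h₀
    (by rw [hF']; exact hnth) hfree (by rw [hM, hF']; exact hodd) θ

end Witnesses

/-! ## §2 The census lists and the cover lemmas -/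

section Lists

/-- Boolean check «the reference block `B` lies in the frame `[0,6]×[−1,5]`, off the hole `(3, 2)` and off both cells of the pair `p`».
[cite: GlazmanManolescu2019, §2.1 (finite domains of faces)] -/
def avoidsI7 (B : List Face) (p : Face × Face) : Bool :=
  B.all fun a => decide (0 ≤ a.1 ∧ a.1 ≤ 6 ∧ -1 ≤ a.2 ∧ a.2 ≤ 5 ∧ a ≠ (3, 2) ∧ a ≠ p.1 ∧ a ≠ p.2)

/-- The Boolean check certifies the placement hypothesis of `block_hroot_subset_boxMinus_pair` for the frame `[0,6]×[−1,5]`.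
[cite: GlazmanManolescu2019, §2.1 (finite domains of faces)] -/
theorem of_avoidsI7 {B : List Face} {p : Face × Face} (h : avoidsI7 B p = true) :
    ∀ a ∈ B, 0 ≤ a.1 ∧ a.1 ≤ 6 ∧ -1 ≤ a.2 ∧ a.2 ≤ 5 ∧ a ≠ (3, 2) ∧ a ≠ p.1 ∧ a ≠ p.2 := by
  intro a ha
  have h' := List.all_eq_true.1 h a ha
  simpa only [decide_eq_true_eq] using h'

/-- ★ THE 44 HARMLESS PAIRS of the ring + near census (reference coordinates: hole `(3, 2)`): one ring cell `≠ farWW` and one near cell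
such that kit j300087 FOUND wound witnesses of all four types (`{pNE, rootS}` by the follow-up j303663).
[cite: GlazmanManolescu2019, §2.1 (finite domains of faces)] -/
def ringNearHarmlessPairs : List (Face × Face) :=
  [((1, 0), (3, 1)), ((1, 0), (3, 3)), ((1, 0), (4, 1)), ((1, 0), (4, 3)), ((1, 1), (3, 1)), ((1, 1), (3, 3)),
  ((1, 1), (4, 1)), ((1, 1), (4, 3)), ((1, 3), (3, 1)), ((1, 3), (3, 3)), ((1, 3), (4, 1)), ((1, 3), (4, 3)),
  ((1, 4), (3, 1)), ((1, 4), (3, 3)), ((1, 4), (4, 1)), ((1, 4), (4, 3)), ((2, 0), (3, 3)), ((2, 0), (4, 1)),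
  ((2, 0), (4, 3)), ((2, 4), (3, 1)), ((2, 4), (4, 1)), ((2, 4), (4, 3)), ((3, 0), (3, 3)), ((3, 0), (4, 3)),
  ((3, 4), (3, 1)), ((3, 4), (4, 1)), ((4, 0), (3, 3)), ((4, 0), (4, 3)), ((4, 4), (3, 1)), ((4, 4), (4, 1)),
  ((5, 0), (3, 1)), ((5, 0), (3, 3)), ((5, 0), (4, 3)), ((5, 1), (3, 1)), ((5, 1), (3, 3)), ((5, 1), (4, 3)),
  ((5, 2), (3, 1)), ((5, 2), (3, 3)), ((5, 3), (3, 1)), ((5, 3), (3, 3)), ((5, 3), (4, 1)), ((5, 4), (3, 1)),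
  ((5, 4), (3, 3)), ((5, 4), (4, 1))]

/-- ★ THE 8 UNDER-ONLY PAIRS: the over route is EMPTY in the frame (ceiling three rows up / east column: `PlaquetteWalkHoleRootCutLaw` §3′
and the parent lineage), the under route is found. [cite: GlazmanManolescu2019, §2.1 (finite domains of faces)] -/
def ringNearUnderPairs : List (Face × Face) :=
  [((2, 4), (3, 3)), ((3, 4), (3, 3)), ((3, 4), (4, 3)), ((4, 4), (3, 3)), ((4, 4), (4, 3)), ((5, 2), (4, 3)),
  ((5, 3), (4, 3)), ((5, 4), (4, 3))]

/-- ★ THE 8 OVER-ONLY PAIRS (row mirrors of the under-only ones): the under route is EMPTY in the frame, the over route is found.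
[cite: GlazmanManolescu2019, §2.1 (finite domains of faces), §4.2 (lattice symmetries)] -/
def ringNearOverPairs : List (Face × Face) :=
  [((2, 0), (3, 1)), ((3, 0), (3, 1)), ((3, 0), (4, 1)), ((4, 0), (3, 1)), ((4, 0), (4, 1)), ((5, 0), (4, 1)),
  ((5, 1), (4, 1)), ((5, 2), (4, 1))]

/-- The three lists are the whole census: 60 distinct pairs = 15 ring cells (Chebyshev distance two from the hole, `farWW = (1, 2)`
excluded) × 4 near cells. [cite: GlazmanManolescu2019, §2.1 (finite domains of faces)] -/
theorem ringNear_pairs_complete :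
    (ringNearHarmlessPairs ++ ringNearUnderPairs ++ ringNearOverPairs).length = 60 ∧
      (ringNearHarmlessPairs ++ ringNearUnderPairs ++ ringNearOverPairs).Nodup ∧
      ∀ p ∈ ringNearHarmlessPairs ++ ringNearUnderPairs ++ ringNearOverPairs,
        (max |p.1.1 - 3| |p.1.2 - 2| = 2 ∧ p.1 ≠ (1, 2)) ∧ (p.2 = (3, 1) ∨ p.2 = (4, 1) ∨ p.2 = (3, 3) ∨ p.2 = (4, 3)) := by
  refine ⟨by decide, by decide, by decide⟩

/-- ★★ UNDER COVER: every pair of the harmless and under-only lists is avoided, inside the frame `[0,6]×[−1,5]` and off the hole, by one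
of the four under blocks. [cite: GlazmanManolescu2019, §2.1 (finite domains of faces)] -/
theorem ringNear_under_cover : ∀ p ∈ ringNearHarmlessPairs ++ ringNearUnderPairs,
    (avoidsI7 pairBlockU142 p || avoidsI7 pairBlockU242 p || avoidsI7 pairBlockU342 p || avoidsI7 pairBlockU442 p) = true := by
  decide

/-- ★★ OVER COVER: every pair of the harmless and over-only lists is avoided, inside the frame and off the hole, by one of the five over
blocks. [cite: GlazmanManolescu2019, §2.1 (finite domains of faces)] -/
theorem ringNear_over_cover : ∀ p ∈ ringNearHarmlessPairs ++ ringNearOverPairs,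
    (avoidsI7 pairBlockO142 p || avoidsI7 pairBlockO242 p || avoidsI7 pairBlockO342 p || avoidsI7 pairBlockO442 p || avoidsI7 pairBlockO542 p) = true := by
  decide

end Lists

/-! ## §3 The census in every box with the hole three cells from the walls -/

section Boxes

variable {m n : ℕ} {S : List Face} {h : Face}

/-- ★★★★★ **UNDER ROUTE: 52 PAIRS CARRY AN UNMARKED WOUND UNDER-WALK IN EVERY BOX.** Hole `h` three cells from every wall
(`3 ≤ h.1`, `h.1 + 4 ≤ m`, `3 ≤ h.2`, `h.2 + 4 ≤ n`); `(c, d)` a harmless or under-only pair (reference coordinates); `S ∋ h` any list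
inside `{h, c + v, d + v}`, `v = (h.1 − 3, h.2 − 2)`. Then the far cell carries a wound class-`B2a` UNDER-walk (first side `S`) that is
`w₁`-free AND `w₂`-free off it. [cite: GlazmanManolescu2019, §1 (Fig. 2 and the remark after eq. (1)), §2.1, §4.2, Lemma 2.1]
[cite: Glazman2015WeightedSAW, Lemma 3.1 (proof, pp. 6–7)] [cite: CourantRobbins1958, Ch. V Appendix §2 (the even–odd rule)] -/
theorem exists_under_unmarked_of_ringNearPair (hW : 3 ≤ h.1) (hE : h.1 + 4 ≤ m) (hS : 3 ≤ h.2) (hN : h.2 + 4 ≤ n) {c d : Face}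
    (hp : (c, d) ∈ ringNearHarmlessPairs ++ ringNearUnderPairs)
    (hSn : ∀ s ∈ S, s = h ∨ s = (c.1 + (h.1 - 3), c.2 + (h.2 - 2)) ∨ s = (d.1 + (h.1 - 3), d.2 + (h.2 - 2)))
    (hr : RootedFace (dom (boxMinus m n S)) (Face.side (h.1 + 1, h.2) .W) (farW (h.1 + 1, h.2))) (θ : ℝ) :
    ∃ (ω : ΩG (dom (boxMinus m n S)) (Face.side (h.1 + 1, h.2) .W) (farW (h.1 + 1, h.2))) (hb : ω.IsB2a),
      ω.2.firstSideG = .S ∧ ω.WE (fun _ => θ) ≠ excursionWinding θ ω.2.firstSideG (ω.z1 hr hb) ω.1 ∧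
        (ω.2.W1FreeOff (farW (h.1 + 1, h.2)) ∧ ω.2.W2FreeOff (farW (h.1 + 1, h.2))) := by
  have key := ringNear_under_cover (c, d) hp
  simp only [Bool.or_eq_true] at key
  rcases key with ((hB | hB) | hB) | hB
  · exact exists_under_unmarked_of_pairBlockU1 (block_hroot_subset_boxMinus_pair pairBlockU142 0 6 (-1) 5 c d
      (of_avoidsI7 hB) (by omega) (by omega) (by omega) (by omega) hSn) hr θ
  · exact exists_under_unmarked_of_pairBlockU2 (block_hroot_subset_boxMinus_pair pairBlockU242 0 6 (-1) 5 c d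
      (of_avoidsI7 hB) (by omega) (by omega) (by omega) (by omega) hSn) hr θ
  · exact exists_under_unmarked_of_pairBlockU3 (block_hroot_subset_boxMinus_pair pairBlockU342 0 6 (-1) 5 c d
      (of_avoidsI7 hB) (by omega) (by omega) (by omega) (by omega) hSn) hr θ
  · exact exists_under_unmarked_of_pairBlockU4 (block_hroot_subset_boxMinus_pair pairBlockU442 0 6 (-1) 5 c d
      (of_avoidsI7 hB) (by omega) (by omega) (by omega) (by omega) hSn) hr θ

/-- ★★★★★ **OVER ROUTE: 52 PAIRS CARRY AN UNMARKED WOUND OVER-WALK IN EVERY BOX** (harmless or over-only pair; same room and defect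
lists). [cite: GlazmanManolescu2019, §1 (Fig. 2 and the remark after eq. (1)), §2.1, §4.2, Lemma 2.1]
[cite: Glazman2015WeightedSAW, Lemma 3.1 (proof, pp. 6–7)] [cite: CourantRobbins1958, Ch. V Appendix §2 (the even–odd rule)] -/
theorem exists_over_unmarked_of_ringNearPair (hW : 3 ≤ h.1) (hE : h.1 + 4 ≤ m) (hS : 3 ≤ h.2) (hN : h.2 + 4 ≤ n) {c d : Face}
    (hp : (c, d) ∈ ringNearHarmlessPairs ++ ringNearOverPairs)
    (hSn : ∀ s ∈ S, s = h ∨ s = (c.1 + (h.1 - 3), c.2 + (h.2 - 2)) ∨ s = (d.1 + (h.1 - 3), d.2 + (h.2 - 2)))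
    (hr : RootedFace (dom (boxMinus m n S)) (Face.side (h.1 + 1, h.2) .W) (farW (h.1 + 1, h.2))) (θ : ℝ) :
    ∃ (ω : ΩG (dom (boxMinus m n S)) (Face.side (h.1 + 1, h.2) .W) (farW (h.1 + 1, h.2))) (hb : ω.IsB2a),
      ω.2.firstSideG = .N ∧ ω.WE (fun _ => θ) ≠ excursionWinding θ ω.2.firstSideG (ω.z1 hr hb) ω.1 ∧
        (ω.2.W1FreeOff (farW (h.1 + 1, h.2)) ∧ ω.2.W2FreeOff (farW (h.1 + 1, h.2))) := by
  have key := ringNear_over_cover (c, d) hp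
  simp only [Bool.or_eq_true] at key
  rcases key with (((hB | hB) | hB) | hB) | hB
  · exact exists_over_unmarked_of_pairBlockO1 (block_hroot_subset_boxMinus_pair pairBlockO142 0 6 (-1) 5 c d
      (of_avoidsI7 hB) (by omega) (by omega) (by omega) (by omega) hSn) hr θ
  · exact exists_over_unmarked_of_pairBlockO2 (block_hroot_subset_boxMinus_pair pairBlockO242 0 6 (-1) 5 c d
      (of_avoidsI7 hB) (by omega) (by omega) (by omega) (by omega) hSn) hr θ
  · exact exists_over_unmarked_of_pairBlockO3 (block_hroot_subset_boxMinus_pair pairBlockO342 0 6 (-1) 5 c d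
      (of_avoidsI7 hB) (by omega) (by omega) (by omega) (by omega) hSn) hr θ
  · exact exists_over_unmarked_of_pairBlockO4 (block_hroot_subset_boxMinus_pair pairBlockO442 0 6 (-1) 5 c d
      (of_avoidsI7 hB) (by omega) (by omega) (by omega) (by omega) hSn) hr θ
  · exact exists_over_unmarked_of_pairBlockO5 (block_hroot_subset_boxMinus_pair pairBlockO542 0 6 (-1) 5 c d
      (of_avoidsI7 hB) (by omega) (by omega) (by omega) (by omega) hSn) hr θ

/-- ★★★★★ **THE 44 HARMLESS PAIRS KILL NOTHING.** Hole three cells from every wall; one ring cell `c ≠ farWW` and one near cell `d` with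
`(c, d) ∈ ringNearHarmlessPairs` removed (any `S ∋ h` inside the three-cell set). Then at every angle NONE of the four universal kill
statements of LAW L holds at the far cell: each route carries a wound walk free in both classes.
[cite: GlazmanManolescu2019, §1 (Fig. 2 and the remark after eq. (1)), §2.1, §4.2, Lemma 2.1]
[cite: Glazman2015WeightedSAW, Lemma 3.1 (proof, pp. 6–7)] [cite: CourantRobbins1958, Ch. V Appendix §2 (the even–odd rule)] -/
theorem lawL_box_ringNearPair_not_killed (hW : 3 ≤ h.1) (hE : h.1 + 4 ≤ m) (hS : 3 ≤ h.2) (hN : h.2 + 4 ≤ n) {c d : Face}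
    (hp : (c, d) ∈ ringNearHarmlessPairs)
    (hSn : ∀ s ∈ S, s = h ∨ s = (c.1 + (h.1 - 3), c.2 + (h.2 - 2)) ∨ s = (d.1 + (h.1 - 3), d.2 + (h.2 - 2)))
    (hr : RootedFace (dom (boxMinus m n S)) (Face.side (h.1 + 1, h.2) .W) (farW (h.1 + 1, h.2))) (θ : ℝ) :
    (¬ ∀ (ω : ΩG (dom (boxMinus m n S)) (Face.side (h.1 + 1, h.2) .W) (farW (h.1 + 1, h.2))) (hb : ω.IsB2a),
        ω.2.firstSideG = .S → ω.WE (fun _ => θ) ≠ excursionWinding θ ω.2.firstSideG (ω.z1 hr hb) ω.1 →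
          ¬ω.2.W2FreeOff (farW (h.1 + 1, h.2))) ∧
      (¬ ∀ (ω : ΩG (dom (boxMinus m n S)) (Face.side (h.1 + 1, h.2) .W) (farW (h.1 + 1, h.2))) (hb : ω.IsB2a),
        ω.2.firstSideG = .N → ω.WE (fun _ => θ) ≠ excursionWinding θ ω.2.firstSideG (ω.z1 hr hb) ω.1 →
          ¬ω.2.W1FreeOff (farW (h.1 + 1, h.2))) ∧
      (¬ ∀ (ω : ΩG (dom (boxMinus m n S)) (Face.side (h.1 + 1, h.2) .W) (farW (h.1 + 1, h.2))) (hb : ω.IsB2a),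
        ω.2.firstSideG = .S → ω.WE (fun _ => θ) ≠ excursionWinding θ ω.2.firstSideG (ω.z1 hr hb) ω.1 →
          ¬ω.2.W1FreeOff (farW (h.1 + 1, h.2))) ∧
      (¬ ∀ (ω : ΩG (dom (boxMinus m n S)) (Face.side (h.1 + 1, h.2) .W) (farW (h.1 + 1, h.2))) (hb : ω.IsB2a),
        ω.2.firstSideG = .N → ω.WE (fun _ => θ) ≠ excursionWinding θ ω.2.firstSideG (ω.z1 hr hb) ω.1 →
          ¬ω.2.W2FreeOff (farW (h.1 + 1, h.2))) := by
  obtain ⟨ωu, hu, hus, huw, hu1, hu2⟩ := exists_under_unmarked_of_ringNearPair hW hE hS hN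
    (List.mem_append.2 (Or.inl hp)) hSn hr θ
  obtain ⟨ωo, ho, hos, how, ho1, ho2⟩ := exists_over_unmarked_of_ringNearPair hW hE hS hN
    (List.mem_append.2 (Or.inl hp)) hSn hr θ
  exact ⟨fun hk => hk ωu hu hus huw hu2, fun hk => hk ωo ho hos how ho1, fun hk => hk ωu hu hus huw hu1,
    fun hk => hk ωo ho hos how ho2⟩

/-- ★★★ **SINGLE CELLS.** A fortiori every single ring cell `c ≠ farWW` and every single near cell is harmless three cells from the walls:
with `S ∋ h` inside `{h, c + v}` for `c` the first OR second coordinate of a harmless pair, none of the four kills holds.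
[cite: GlazmanManolescu2019, §1 (Fig. 2 and the remark after eq. (1)), §2.1, §4.2, Lemma 2.1]
[cite: Glazman2015WeightedSAW, Lemma 3.1 (proof, pp. 6–7)] -/
theorem lawL_box_ringNearSingle_not_killed (hW : 3 ≤ h.1) (hE : h.1 + 4 ≤ m) (hS : 3 ≤ h.2) (hN : h.2 + 4 ≤ n) {c d : Face}
    (hp : (c, d) ∈ ringNearHarmlessPairs)
    (hSn : (∀ s ∈ S, s = h ∨ s = (c.1 + (h.1 - 3), c.2 + (h.2 - 2))) ∨ ∀ s ∈ S, s = h ∨ s = (d.1 + (h.1 - 3), d.2 + (h.2 - 2)))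
    (hr : RootedFace (dom (boxMinus m n S)) (Face.side (h.1 + 1, h.2) .W) (farW (h.1 + 1, h.2))) (θ : ℝ) :
    (¬ ∀ (ω : ΩG (dom (boxMinus m n S)) (Face.side (h.1 + 1, h.2) .W) (farW (h.1 + 1, h.2))) (hb : ω.IsB2a),
        ω.2.firstSideG = .S → ω.WE (fun _ => θ) ≠ excursionWinding θ ω.2.firstSideG (ω.z1 hr hb) ω.1 →
          ¬ω.2.W2FreeOff (farW (h.1 + 1, h.2))) ∧
      (¬ ∀ (ω : ΩG (dom (boxMinus m n S)) (Face.side (h.1 + 1, h.2) .W) (farW (h.1 + 1, h.2))) (hb : ω.IsB2a),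
        ω.2.firstSideG = .N → ω.WE (fun _ => θ) ≠ excursionWinding θ ω.2.firstSideG (ω.z1 hr hb) ω.1 →
          ¬ω.2.W1FreeOff (farW (h.1 + 1, h.2))) ∧
      (¬ ∀ (ω : ΩG (dom (boxMinus m n S)) (Face.side (h.1 + 1, h.2) .W) (farW (h.1 + 1, h.2))) (hb : ω.IsB2a),
        ω.2.firstSideG = .S → ω.WE (fun _ => θ) ≠ excursionWinding θ ω.2.firstSideG (ω.z1 hr hb) ω.1 →
          ¬ω.2.W1FreeOff (farW (h.1 + 1, h.2))) ∧
      (¬ ∀ (ω : ΩG (dom (boxMinus m n S)) (Face.side (h.1 + 1, h.2) .W) (farW (h.1 + 1, h.2))) (hb : ω.IsB2a),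
        ω.2.firstSideG = .N → ω.WE (fun _ => θ) ≠ excursionWinding θ ω.2.firstSideG (ω.z1 hr hb) ω.1 →
          ¬ω.2.W2FreeOff (farW (h.1 + 1, h.2))) := by
  refine lawL_box_ringNearPair_not_killed hW hE hS hN hp (fun s hs => ?_) hr θ
  rcases hSn with h1 | h1
  · rcases h1 s hs with e | e
    · exact Or.inl e
    · exact Or.inr (Or.inl e)
  · rcases h1 s hs with e | e
    · exact Or.inl e
    · exact Or.inr (Or.inr e)

end Boxes

end Literature.Barriers.CriticalPhenomena.PlaquetteWalk
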